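import Mathlib
import Literature.RepresentationTheory.FiniteGroups.GLnCharacterDegreeBound
import Summits.MatrixMultiplication.MatrixMultiplication.Theorems.LieRankDesigns.Negative.Basics
import Summits.MatrixMultiplication.MatrixMultiplication.Theorems.LevelGradedCohnUmansLieRankDesignsUniversality

/-!
# `SubgroupIdentityDesigns` (stmt-MatrixMultiplication-14079), line `levi-free-rigid-outer-pieces`:
stub `stub_sharpBudget_of_green`

Crux `Summit.MatrixMultiplication.MatrixMultiplication.Theses.LevelGradedCohnUmans.SubgroupIdentityDesigns`;
this file proves the registered stub `stub_sharpBudget_of_green` verbatim (name + signature): Green's degree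
bound for `GL_n(𝔽_p)` (the named fact `GreenGLnDegreeBound`, taken as the HYPOTHESIS of the implication, never
asserted) implies the SHARP level-`k` budget of `GL_m(𝔽_p)`,

  `Σ_{χ ∈ Irr(GL_m(𝔽_p)) ∩ F_k} χ(1)^s ≤ C_{m,k}^s · p^{s(mk - k²/2 - k/2) + k}`   (`1 ≤ k`, `2k ≤ m`, `s ≥ 2`),

with `C_{m,k} = 2^{m+k}`.  It is pure glue of three landed theorems of the `LieRankDesigns` line:

* `LieRankDesigns.stub_sharpLevelDegree` — Green's bound gives the sharp level degree
  `χ(1) ≤ 2^{m+k} p^{mk - k²/2 - k/2}` on `Irr ∩ F_k` (its hypothesis is `GreenGLnDegreeBound` unfolded);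
* `LieRankDesigns.cellBudget_of_stubs` — the cell budget
  `budget p m k s · (p-1)^{(s-2)/2} ≤ 2^{m(s-1)} p^{(mk - k²/2)s}`;
* `LieRankDesigns.Universality.sharpCellBudget_of` — the two combine to the sharp cell budget
  `budget p m k s ≤ 2^{(m+k)(s-2)+m} · p^{(2mk - k²) + (s-2)(mk - k²/2 - k/2)}`.

What is left is real-exponent bookkeeping: `(2mk - k²) + (s-2)(mk - k²/2 - k/2) = s(mk - k²/2 - k/2) + k`
and `2^{(m+k)(s-2)+m} ≤ 2^{(m+k)s} = (2^{m+k})^s`.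
-/

set_option linter.dupNamespace false

noncomputable section

open scoped BigOperators
open Literature.RepresentationTheory.FiniteGroups
open Summit.MatrixMultiplication.MatrixMultiplication.Theorems.LieRankDesigns.Negative
  (GLm Mat levelSet budget)

namespace Summit.MatrixMultiplication.MatrixMultiplication.Theorems.LeviFreeRigidOuterPieces

open Summit.MatrixMultiplication.MatrixMultiplication.Theorems.LieRankDesigns
  (stub_sharpLevelDegree cellBudget_of_stubs)
open Summit.MatrixMultiplication.MatrixMultiplication.Theorems.LieRankDesigns.Universality
  (sharpCellBudget_of)

/-- The sharp cell budget of the `LieRankDesigns` line, CONDITIONAL on Green's degree bound (hypothesis):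
`budget p m k s ≤ 2^{(m+k)(s-2)+m} · p^{(2mk - k²) + (s-2)(mk - k²/2 - k/2)}` for `1 ≤ k ≤ m`, `s ≥ 2` —
`Universality.sharpCellBudget_of` fed with `stub_sharpLevelDegree hGreen` and `cellBudget_of_stubs`. -/
theorem sharpCellBudget_of_green (hGreen : GreenGLnDegreeBound) :
    ∀ (p m k : ℕ) [Fact p.Prime], 1 ≤ k → k ≤ m → ∀ s : ℝ, 2 ≤ s →
      budget p m k s ≤
        2 ^ (((m : ℝ) + k) * (s - 2) + m) *
          (p : ℝ) ^ ((2 * (m : ℝ) * k - (k : ℝ) ^ 2) +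
            (s - 2) * ((m : ℝ) * k - (k : ℝ) ^ 2 / 2 - (k : ℝ) / 2)) :=
  sharpCellBudget_of
    (fun p m k _ hk hkm χ hχ => stub_sharpLevelDegree hGreen p m k hk hkm χ hχ)
    (fun p m k _ hk hkm s hs => cellBudget_of_stubs p m k hk hkm s hs)

/-- The constant bookkeeping: `2^{(m+k)(s-2)+m} ≤ (2^{m+k})^s` for `s` real and `m, k : ℕ`
(as `(m+k)(s-2) + m ≤ (m+k)s`, i.e. `m ≤ 2(m+k)`). -/
theorem two_rpow_const_le (m k : ℕ) (s : ℝ) :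
    (2 : ℝ) ^ (((m : ℝ) + k) * (s - 2) + m) ≤ ((2 : ℝ) ^ ((m : ℝ) + k)) ^ s := by
  rw [← Real.rpow_mul (by norm_num : (0 : ℝ) ≤ 2)]
  apply Real.rpow_le_rpow_of_exponent_le (by norm_num : (1 : ℝ) ≤ 2)
  have hm0 : (0 : ℝ) ≤ m := Nat.cast_nonneg m
  have hk0 : (0 : ℝ) ≤ k := Nat.cast_nonneg k
  nlinarith

/-- **Stub `stub_sharpBudget_of_green`** (registered signature, line `levi-free-rigid-outer-pieces` of the crux
`SubgroupIdentityDesigns`): Green's degree bound for `GL_n(𝔽_p)` (the tree's named fact `GreenGLnDegreeBound`,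
hypothesis) implies the SHARP level-`k` budget of `GL_m(𝔽_p)`: there is `C : ℕ → ℕ → ℝ` with `C m k ≥ 1`
(here `C m k = 2^{m+k}`) such that for every prime `p`, `1 ≤ k`, `2k ≤ m` and real `s ≥ 2`,
`Σ_{χ ∈ Irr(GL_m(𝔽_p)) ∩ F_k} χ(1)^s ≤ (C m k)^s · p^{s(mk - k²/2 - k/2) + k}`.  Proof: the conditional sharp
cell budget `sharpCellBudget_of_green` (valid for all `1 ≤ k ≤ m`), the exponent identity
`(2mk - k²) + (s-2)(mk - k²/2 - k/2) = s(mk - k²/2 - k/2) + k` and `2^{(m+k)(s-2)+m} ≤ (2^{m+k})^s`. -/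
theorem stub_sharpBudget_of_green :
    Literature.RepresentationTheory.FiniteGroups.GreenGLnDegreeBound →
    ∃ C : ℕ → ℕ → ℝ, (∀ m k : ℕ, 1 ≤ C m k) ∧
      ∀ (p m k : ℕ) [Fact p.Prime] (s : ℝ), 1 ≤ k → 2 * k ≤ m → 2 ≤ s →
        budget p m k s ≤ C m k ^ s * (p : ℝ) ^ (s * ((m : ℝ) * k - (k : ℝ) ^ 2 / 2 - k / 2) + k) := by
  intro hGreen
  refine ⟨fun m k => (2 : ℝ) ^ ((m : ℝ) + k), fun m k => ?_, ?_⟩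
  · exact Real.one_le_rpow (by norm_num) (by positivity)
  · intro p m k _ s hk hkm hs
    have h := sharpCellBudget_of_green hGreen p m k hk (by omega) s hs
    have hE : (2 * (m : ℝ) * k - (k : ℝ) ^ 2) + (s - 2) * ((m : ℝ) * k - (k : ℝ) ^ 2 / 2 - (k : ℝ) / 2)
        = s * ((m : ℝ) * k - (k : ℝ) ^ 2 / 2 - k / 2) + k := by ring
    rw [hE] at h
    exact le_trans h (mul_le_mul_of_nonneg_right (two_rpow_const_le m k s) (by positivity))

end Summit.MatrixMultiplication.MatrixMultiplication.Theorems.LeviFreeRigidOuterPieces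

end
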